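import Summits.AtomisticToContinuum.Crystallization.Theorems.ChargedEnergyGapSeamTransferA
import HarnessLib

/-!
# «SeamTransfer» (lens-3 g55 P-C, line 14231) — part B (sequel of `…ChargedEnergyGapSeamTransferA`)
LANDING BANNER (critic row 1115 (6); landing lane hand-2 g31): the (H𝄪)/(N𝄪)-type RECORD pieces of this lens-3 g53–g56 engine are VACUOUS at μ₀ > 0 — `harmStableWith_nonpos` (lens-3 g61, `…ChargedEnergyGapRotationGauge`); superseded by the …R designate ((H𝄪ʳ) `LocalSeamTransferBoundR`, (N𝄪ʳ) `LocalSeamReductionR` of `…ChargedEnergyGapRotationRepair`).  Landed as an ENGINE: the transfer / reduction lemmas below are consumed by P-I.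

Split for the 400-line cap by the landing lane (hand-2 g29); the module docstring of part A describes the whole node.  Same namespace; all FQNs unchanged.
0 sorry; standard axioms.
-/

noncomputable section
open scoped Classical
open Literature.MathematicalPhysics.StatisticalMechanics
open Literature.Geometry.DiscreteGeometry
open Summit.AtomisticToContinuum.Crystallization.Theses.PricedLinkCensus
open Summit.AtomisticToContinuum.Crystallization.Theorems.ChargedEnergyGapNegative

namespace Summit.AtomisticToContinuum.Crystallization.Theorems.ChargedEnergyGapChartDial

/-! ## §2 The two pieces, (Hˢ) ⟹ (H♯) ⟹ (H♭) ⟹ (H), (N♯) ⟹ (Nˢ), glue, WEAKER, dials -/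

section Pieces

variable (s lam ℓ μ₀ τ lamQ ϱ b₀ r_S C_T : ℝ)

/-- piece SEAM-TRANSFER(`C_T`, `b₀`, `r_S`) · STRONGER than VOLTERRA-TRANSFER (`volterraTransferBoundC_of_seam`, `b₀ ≤ s`) and than
HARM-TRANSFER♭ (`harmonicTransferBoundC_of_seam`) · UNDECIDED→TRUE-leaning at the record · INSTRUMENTABLE (via (H): C10/C11/C13/C15; new
C16 (b)) · ATTACKABLE-M+.  **THE SEAM TRANSFER BOUND**: some `C_H ≥ 0` such that for every `s`-separated, Barlow-labelled reference `P` in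
force and stress equilibrium with stability margin `μ₀` over global cocycles, every `Λ_P`-invariant centre set `C` and excised set `X`,
every global bond cocycle `β₀` and every SEAM system `S` (planar pieces of in-radius `≥ r_S`, Burgers vectors `0` or of norm `≥ b₀`,
transversal to reference bonds) whose Volterra bond field `β₀ + J_S` has strain `≤ τ` on non-excised pairs, the profile-weighted harmonic
model of the far account on `β₀ + J_S` is at least `−C_T·(model shell count) − C_H·(near-priced excised count)`.  Why it might fail:
everything that threatens (H♯) (curved or creased shells, polytype references, soft Bloch sectors near `μ₀`, the two linear Volterra terms
of a cored line against the weighted shell share of its line energy — margin `×4` at `λ = 1/2`), PLUS (i) a floored but small Burgers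
vector `b₀ ≤ ‖b‖ < s` on an uncored rim whose forced collar is shallower (`‖b‖/(2πτ) ≈ 2` deep at `‖b‖ = 2/5`) so that the collar price
must now also cover the rim's linear tail term (estimate: `C_H ≥ 10⁻²` per collar site suffices), (ii) a free far excision facing the
weighted region across a gap of exactly `3ϱ/8 = 60` (tail-priced: `≤ 10⁻⁶` per facing site, inside `C_T`-free plateau only if the facing
sites are plateau sites — they are priced shell/collar sites otherwise).  At `b₀ ≤ 0` the statement is FALSE (unfloored rim discs). -/
def SeamTransferBoundC : Prop :=
  ∃ C_H : ℝ, 0 ≤ C_H ∧ ∀ (P : PeriodicConfiguration 3) (C X : Set E3) (β₀ : E3 → E3 → E3) (k : ℕ) (S : Fin k → CutPiece),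
    IsSeparatedRef s P → IsLabelledRef lam ℓ P → IsForceFree P → IsStressFree P → HarmStableWith μ₀ P →
    IsInvariantSet P C → IsInvariantSet P X → IsGlobalCocycle P β₀ → IsSeamSystem b₀ r_S P S →
    SmallStrain τ P X (volterraField P S β₀) →
      -(C_T * (modelShellCount P X ϱ C : ℝ)) - C_H * (pricedNearCount P X ϱ C : ℝ) ≤
        modelFar (volterraField P S β₀) P X lamQ ϱ C

variable {s lam ℓ μ₀ τ lamQ ϱ b₀ r_S C_T}

/-- ★ **(Hˢ) ⟹ (H♯)** for `b₀ ≤ s`: the seam transfer bound implies the Volterra transfer bound (cut systems are seam systems; near-priced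
`≤` priced).  Hence (H♭), (H) and the census kill path of record stay valid for (Hˢ). -/
theorem volterraTransferBoundC_of_seam (hb : b₀ ≤ s) (h : SeamTransferBoundC s lam ℓ μ₀ τ lamQ ϱ b₀ r_S C_T) :
    VolterraTransferBoundC s lam ℓ μ₀ τ lamQ ϱ r_S C_T := by
  obtain ⟨C_H, hH, h⟩ := h
  refine ⟨C_H, hH, fun P C X β₀ k S h1 h2 h3 h4 h5 h6 h7 h8 h9 h10 => ?_⟩
  have key := h P C X β₀ k S h1 h2 h3 h4 h5 h6 h7 h8 (isSeamSystem_of_isCutSystem h1 hb h9) h10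
  have hle : (pricedNearCount P X ϱ C : ℝ) ≤ (pricedExcisedCount P X ϱ C : ℝ) := by
    exact_mod_cast pricedNearCount_le_pricedExcisedCount
  have hm := mul_le_mul_of_nonneg_left hle hH
  linarith

/-- ★ **(Hˢ) ⟹ (H♭)** at EVERY floor (the empty seam system needs none). -/
theorem harmonicTransferBoundC_of_seam (h : SeamTransferBoundC s lam ℓ μ₀ τ lamQ ϱ b₀ r_S C_T) :
    HarmonicTransferBoundC s lam ℓ μ₀ τ lamQ ϱ C_T := by
  obtain ⟨C_H, hH, h⟩ := h
  refine ⟨C_H, hH, fun P C X β h1 h2 h3 h4 h5 h6 h7 h8 h9 => ?_⟩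
  have key := h P C X β 0 Fin.elim0 h1 h2 h3 h4 h5 h6 h7 h8 (isSeamSystem_fin_zero _)
    (by rw [volterraField_fin_zero]; exact h9)
  rw [volterraField_fin_zero] at key
  have hle : (pricedNearCount P X ϱ C : ℝ) ≤ (pricedExcisedCount P X ϱ C : ℝ) := by
    exact_mod_cast pricedNearCount_le_pricedExcisedCount
  have hm := mul_le_mul_of_nonneg_left hle hH
  linarith

/-- … and hence the displacement-field version (H), the census kill path of record: a refutation of (H) refutes (Hˢ). -/
theorem harmonicTransferBound_of_seam (h : SeamTransferBoundC s lam ℓ μ₀ τ lamQ ϱ b₀ r_S C_T) :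
    HarmonicTransferBound s lam ℓ μ₀ τ lamQ ϱ C_T :=
  harmonicTransferBound_of_cocycle (harmonicTransferBoundC_of_seam h)

variable (s lam ℓ μ₀ τ lamQ ϱ b₀ r_S C_T)
variable {θ ε R r η L δ L' : ℝ} (W : CoreWeights θ ε R r η L δ L' ϱ) (c₁ ρ₀ B₀ : ℝ)

/-- piece SEAM-REDUCTION_W · WEAKER than VOLTERRA-REDUCTION_W (`seamReductionW_of_volterraReduction`, `b₀ ≤ s`), than HARM-REDUCTION_W
(`seamReductionW_of_harmonicReduction`) and than CB-FAR_W|cored,`B₀` (`seamReductionW_of_budget`) · UNDECIDED (TRUE-leaning with the leaf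
for the max cover) · ATTACKABLE-L (clean labelled far components that are, grain by grain — grains decoupled by FREE FAR EXCISION behind
cored / other-gross walls — ONE Barlow lattice orientation up to elastic distortion, with ARBITRARY stacking-seam content: faults, ribbons
of any width, first-generation Σ3 twin lamellae, stacking disorder, oblique {111} seam families with cored junctions; arbitrary centred
perfect and partial dislocation content; priced holes) | IDEA-NEEDED ((γ′) networks of `≥ 3` mutually rotated twin variants meeting along
coherent faces; (ε) charted-charged coherent misoriented walls, if any).  **THE SEAM REDUCTION**: the seam transfer bound implies the
budget far leaf.  Content (memo g55 §2–§3): as (N♯), the far region of each grain charted by `β₀ = δ(S + v)` — `S` the piecewise partial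
translation of the stacking sequence relative to the grain's reference, `v` periodic elastic — plus the seam system of the BOUNDED seams
(ribbons between cored partials, lamella faces ending at cored junctions) and the glide cuts; complete seams need no piece; per seam area
the actual account exceeds the model by the unrelaxed fault energy minus its strain derivative at strain `≤ τ` (`≥ 0` in the e* phase by
layerwise optimality of hcp; in c-stacked grains the negative fault energy is paid by the bulk surplus of the stacking); other grains
excised, free beyond `3ϱ/8`, their cored walls free, other-gross wall patches priced and paid by the debit.  Why it might fail: only with
the leaf (implied by it) — as a PROOF TASK it is open exactly on the residual (γ′)/(ε) above. -/
def SeamReductionW : Prop :=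
  SeamTransferBoundC s lam ℓ μ₀ τ lamQ ϱ b₀ r_S C_T → FarLabelledFloorCoredBudgetW W c₁ s ρ₀ lam ℓ B₀

variable {s lam ℓ μ₀ τ lamQ ϱ b₀ r_S C_T W c₁ ρ₀ B₀}

/-- ★ **THE SPLIT** (glue, proved; bridge split by modus ponens): SEAM-TRANSFER ∧ SEAM-REDUCTION_W ⟹ CB-FAR_W|cored,`B₀`. -/
theorem farLabelledFloorCoredBudgetW_of_seam (hS : SeamTransferBoundC s lam ℓ μ₀ τ lamQ ϱ b₀ r_S C_T)
    (hN : SeamReductionW s lam ℓ μ₀ τ lamQ ϱ b₀ r_S C_T W c₁ ρ₀ B₀) : FarLabelledFloorCoredBudgetW W c₁ s ρ₀ lam ℓ B₀ :=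
  hN hS

/-- ★ WEAKER: VOLTERRA-REDUCTION_W ⟹ SEAM-REDUCTION_W for `b₀ ≤ s` (the reduction got easier: its hypothesis got stronger). -/
theorem seamReductionW_of_volterraReduction (hb : b₀ ≤ s) (h : VolterraReductionW s lam ℓ μ₀ τ lamQ ϱ r_S C_T W c₁ ρ₀ B₀) :
    SeamReductionW s lam ℓ μ₀ τ lamQ ϱ b₀ r_S C_T W c₁ ρ₀ B₀ :=
  fun hS => h (volterraTransferBoundC_of_seam hb hS)

/-- WEAKER: HARM-REDUCTION_W ⟹ SEAM-REDUCTION_W at every floor. -/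
theorem seamReductionW_of_harmonicReduction (h : HarmonicReductionW s lam ℓ μ₀ τ lamQ ϱ C_T W c₁ ρ₀ B₀) :
    SeamReductionW s lam ℓ μ₀ τ lamQ ϱ b₀ r_S C_T W c₁ ρ₀ B₀ :=
  fun hS => h (harmonicTransferBoundC_of_seam hS)

/-- WEAKER: the budget far leaf implies SEAM-REDUCTION_W at every dial. -/
theorem seamReductionW_of_budget (h : FarLabelledFloorCoredBudgetW W c₁ s ρ₀ lam ℓ B₀) :
    SeamReductionW s lam ℓ μ₀ τ lamQ ϱ b₀ r_S C_T W c₁ ρ₀ B₀ :=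
  fun _ => h

/-- The four-generation chain in one line: SHELL-BUDGET_W ∧ SEAM-TRANSFER ∧ SEAM-REDUCTION_W ⟹ CB-FAR_W|cored (parts O-D, P-A, P-B, P-C). -/
theorem farLabelledFloorCoredW_of_seam_shellBudget (hB : ShellBudgetW W s B₀)
    (hS : SeamTransferBoundC s lam ℓ μ₀ τ lamQ ϱ b₀ r_S C_T) (hN : SeamReductionW s lam ℓ μ₀ τ lamQ ϱ b₀ r_S C_T W c₁ ρ₀ B₀) :
    FarLabelledFloorCoredW W c₁ s ρ₀ lam ℓ :=
  farLabelledFloorCoredW_of_shellBudget W hB (farLabelledFloorCoredBudgetW_of_seam hS hN)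

/-- SEAM-TRANSFER is monotone in the transfer constant `C_T` … -/
theorem SeamTransferBoundC.mono_CT {C_T' : ℝ} (hC : C_T ≤ C_T') (h : SeamTransferBoundC s lam ℓ μ₀ τ lamQ ϱ b₀ r_S C_T) :
    SeamTransferBoundC s lam ℓ μ₀ τ lamQ ϱ b₀ r_S C_T' := by
  obtain ⟨C_H, hH, h⟩ := h
  refine ⟨C_H, hH, fun P C X β₀ k S h1 h2 h3 h4 h5 h6 h7 h8 h9 h10 => ?_⟩
  have key := h P C X β₀ k S h1 h2 h3 h4 h5 h6 h7 h8 h9 h10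
  have hm : C_T * (modelShellCount P X ϱ C : ℝ) ≤ C_T' * (modelShellCount P X ϱ C : ℝ) :=
    mul_le_mul_of_nonneg_right hC (Nat.cast_nonneg _)
  linarith

/-- … antitone in the strain amplitude `τ` (fewer test data) … -/
theorem SeamTransferBoundC.anti_tau {τ' : ℝ} (hτ : τ' ≤ τ) (h : SeamTransferBoundC s lam ℓ μ₀ τ lamQ ϱ b₀ r_S C_T) :
    SeamTransferBoundC s lam ℓ μ₀ τ' lamQ ϱ b₀ r_S C_T := by
  obtain ⟨C_H, hH, h⟩ := h
  refine ⟨C_H, hH, fun P C X β₀ k S h1 h2 h3 h4 h5 h6 h7 h8 h9 h10 => h P C X β₀ k S h1 h2 h3 h4 h5 h6 h7 h8 h9 ?_⟩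
  intro y hy z hz hyX hzX
  exact (h10 y hy z hz hyX hzX).trans (mul_le_mul_of_nonneg_right hτ dist_nonneg)

/-- … monotone in the stability margin `μ₀` (fewer references) … -/
theorem SeamTransferBoundC.mono_mu {μ₀' : ℝ} (hμ : μ₀ ≤ μ₀') (h : SeamTransferBoundC s lam ℓ μ₀ τ lamQ ϱ b₀ r_S C_T) :
    SeamTransferBoundC s lam ℓ μ₀' τ lamQ ϱ b₀ r_S C_T := by
  obtain ⟨C_H, hH, h⟩ := h
  refine ⟨C_H, hH, fun P C X β₀ k S h1 h2 h3 h4 h5 h6 h7 h8 h9 h10 => h P C X β₀ k S h1 h2 h3 h4 ?_ h6 h7 h8 h9 h10⟩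
  intro γ hγ
  have h0 : 0 ≤ ∑ y ∈ P.motif, dirichletSite γ P y :=
    Finset.sum_nonneg fun y _ => tsum_nonneg fun _ => sq_nonneg _
  exact (mul_le_mul_of_nonneg_right hμ h0).trans (h5 γ hγ)

/-- … monotone in the separation `s` (fewer references) … -/
theorem SeamTransferBoundC.mono_s {s' : ℝ} (hs : s ≤ s') (h : SeamTransferBoundC s lam ℓ μ₀ τ lamQ ϱ b₀ r_S C_T) :
    SeamTransferBoundC s' lam ℓ μ₀ τ lamQ ϱ b₀ r_S C_T := by
  obtain ⟨C_H, hH, h⟩ := h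
  exact ⟨C_H, hH, fun P C X β₀ k S h1 h2 h3 h4 h5 h6 h7 h8 h9 h10 =>
    h P C X β₀ k S (fun y hy z hz hne => hs.trans (h1 y hy z hz hne)) h2 h3 h4 h5 h6 h7 h8 h9 h10⟩

/-- … antitone in the labelling tolerance `lam` of the reference (fewer references) … -/
theorem SeamTransferBoundC.anti_lam {lam' : ℝ} (hlam : lam' ≤ lam) (h : SeamTransferBoundC s lam ℓ μ₀ τ lamQ ϱ b₀ r_S C_T) :
    SeamTransferBoundC s lam' ℓ μ₀ τ lamQ ϱ b₀ r_S C_T := by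
  obtain ⟨C_H, hH, h⟩ := h
  exact ⟨C_H, hH, fun P C X β₀ k S h1 h2 h3 h4 h5 h6 h7 h8 h9 h10 =>
    h P C X β₀ k S h1 (fun y hy => (h2 y hy).mono hlam) h3 h4 h5 h6 h7 h8 h9 h10⟩

/-- … monotone in the in-radius threshold `r_S` (fewer seam systems) … -/
theorem SeamTransferBoundC.mono_rS {r_S' : ℝ} (hr : r_S ≤ r_S') (h : SeamTransferBoundC s lam ℓ μ₀ τ lamQ ϱ b₀ r_S C_T) :
    SeamTransferBoundC s lam ℓ μ₀ τ lamQ ϱ b₀ r_S' C_T := by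
  obtain ⟨C_H, hH, h⟩ := h
  exact ⟨C_H, hH, fun P C X β₀ k S h1 h2 h3 h4 h5 h6 h7 h8 h9 h10 =>
    h P C X β₀ k S h1 h2 h3 h4 h5 h6 h7 h8 (h9.anti hr) h10⟩

/-- … and monotone in the floor `b₀` (fewer seam systems) — the new dial; the safe direction for a dial move is UP (towards `s`). -/
theorem SeamTransferBoundC.mono_b0 {b₀' : ℝ} (hb : b₀ ≤ b₀') (h : SeamTransferBoundC s lam ℓ μ₀ τ lamQ ϱ b₀ r_S C_T) :
    SeamTransferBoundC s lam ℓ μ₀ τ lamQ ϱ b₀' r_S C_T := by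
  obtain ⟨C_H, hH, h⟩ := h
  exact ⟨C_H, hH, fun P C X β₀ k S h1 h2 h3 h4 h5 h6 h7 h8 h9 h10 =>
    h P C X β₀ k S h1 h2 h3 h4 h5 h6 h7 h8 (h9.anti_floor hb) h10⟩

/-- SEAM-REDUCTION_W is antitone in `C_T` … -/
theorem SeamReductionW.anti_CT {C_T' : ℝ} (hC : C_T' ≤ C_T) (h : SeamReductionW s lam ℓ μ₀ τ lamQ ϱ b₀ r_S C_T W c₁ ρ₀ B₀) :
    SeamReductionW s lam ℓ μ₀ τ lamQ ϱ b₀ r_S C_T' W c₁ ρ₀ B₀ :=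
  fun hS => h (hS.mono_CT hC)

/-- … monotone in the strain amplitude `τ` … -/
theorem SeamReductionW.mono_tau {τ' : ℝ} (hτ : τ ≤ τ') (h : SeamReductionW s lam ℓ μ₀ τ lamQ ϱ b₀ r_S C_T W c₁ ρ₀ B₀) :
    SeamReductionW s lam ℓ μ₀ τ' lamQ ϱ b₀ r_S C_T W c₁ ρ₀ B₀ :=
  fun hS => h (hS.anti_tau hτ)

/-- … antitone in the stability margin `μ₀` … -/
theorem SeamReductionW.anti_mu {μ₀' : ℝ} (hμ : μ₀' ≤ μ₀) (h : SeamReductionW s lam ℓ μ₀ τ lamQ ϱ b₀ r_S C_T W c₁ ρ₀ B₀) :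
    SeamReductionW s lam ℓ μ₀' τ lamQ ϱ b₀ r_S C_T W c₁ ρ₀ B₀ :=
  fun hS => h (hS.mono_mu hμ)

/-- … antitone in the in-radius threshold `r_S` … -/
theorem SeamReductionW.anti_rS {r_S' : ℝ} (hr : r_S' ≤ r_S) (h : SeamReductionW s lam ℓ μ₀ τ lamQ ϱ b₀ r_S C_T W c₁ ρ₀ B₀) :
    SeamReductionW s lam ℓ μ₀ τ lamQ ϱ b₀ r_S' C_T W c₁ ρ₀ B₀ :=
  fun hS => h (hS.mono_rS hr)

/-- … antitone in the floor `b₀` (a reduction may declare seams of smaller translation when the transfer bound admits them) … -/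
theorem SeamReductionW.anti_b0 {b₀' : ℝ} (hb : b₀' ≤ b₀) (h : SeamReductionW s lam ℓ μ₀ τ lamQ ϱ b₀ r_S C_T W c₁ ρ₀ B₀) :
    SeamReductionW s lam ℓ μ₀ τ lamQ ϱ b₀' r_S C_T W c₁ ρ₀ B₀ :=
  fun hS => h (hS.mono_b0 hb)

/-- … monotone in the slack `c₁` and antitone in the budget `B₀` (inherited from the leaf). -/
theorem SeamReductionW.mono_c {c₁' B₀' : ℝ} (hc : c₁ ≤ c₁') (hB : B₀' ≤ B₀)
    (h : SeamReductionW s lam ℓ μ₀ τ lamQ ϱ b₀ r_S C_T W c₁ ρ₀ B₀) :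
    SeamReductionW s lam ℓ μ₀ τ lamQ ϱ b₀ r_S C_T W c₁' ρ₀ B₀' :=
  fun hS => ((h hS).mono W hc).anti W hB

end Pieces

/-! ## §3 The record dials `(μ₀, τ, λ, b₀, r_S, C_T) = (1/100, 3/100, 1/2, 2/5, 3, 1/(3·10⁶))` and ★★ the ten-leaf cones -/

section Record

/-- The record floor lies below the record separation `s = 3/5`: every cut system of record is a seam system of record, (Hˢ) ⟹ (H♯). -/
theorem record_floor_le_sep : (2 : ℝ) / 5 ≤ 3 / 5 := by norm_num

/-- The record floor admits the Shockley partials: the partial translation `a/√3` of a close-packed layer of spacing `a ≥ 7/10` has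
`‖t‖² = a²/3 ≥ (2/5)²` (labelled far sites have local spacing `≥ 0.85` even at the charting tolerance `θ = 3/20`). -/
theorem record_floor_admits_partials : ((2 : ℝ) / 5) ^ 2 ≤ ((7 : ℝ) / 10) ^ 2 / 3 := by norm_num

/-- The record floor keeps the collar mechanism: a nearest-neighbour triangle (side `≤ R = 6/5`) linked with an uncancelled seam rim
carries a bond value `≥ b₀/3`, which exceeds the admissible strain `τ·R` — `3·τ·R < b₀`. -/
theorem record_floor_forces_collar : 3 * ((3 : ℝ) / 100 * (6 / 5)) < 2 / 5 := by norm_num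

/-- Free far excision at the record `ϱ = 160`: a free excised site is `≥ 3ϱ/8 = 60` from every weighted site, and the free core zone
(within `ϱ/8 = 20` of `C`) is the special case `ϱ/2 − 3ϱ/8 = ϱ/8`. -/
theorem record_free_excision_range : 3 * (160 : ℝ) / 8 = 60 ∧ (160 : ℝ) / 2 - 3 * 160 / 8 = 160 / 8 := by norm_num

/-- Plausibility arithmetic of memo g55 §2 for the seam bookkeeping of (Nˢ) in the e* phase (census C14-30: `γ_I2 = 2.786·10⁻⁴` per unit
area; strain derivative estimated `≤ 3·10⁻³`, census C16 (a) pending): at adversarial strain `τ = 3/100` the unrelaxed fault energy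
still dominates, `τ·|∂γ/∂ε| < γ_I2`. -/
theorem record_seam_margin : (3 : ℝ) / 100 * (3 / 1000) < 2786 / 10000000 := by norm_num

/-- ★★ **THE TEN-LEAF RECORD CONE FOR EVERY WEIGHT SYSTEM**: `ChargeRecount · IP_G · FCP_G · CCP_G · REG-BALL_W · LABEL_W ·
SHELL-BUDGET_W(10⁵) · SEAM-TRANSFER(1/(3·10⁶), 2/5, 3) · SEAM-REDUCTION_W · P_G ⟹ ChargedEnergyGap` at the record dials, any `ϱ`, any `W`. -/
theorem chargedEnergyGap_of_seamLedger {ϱ : ℝ} (W : CoreWeights (3 / 20) (1 / 10) (6 / 5) 10 (1 / 100) 40 (1 / 10) 40 ϱ)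
    (hF : ChargeRecount)
    (hIP : ImprovablePricingG (3 / 20) (1 / 10) (6 / 5) 10 (1 / 100) (3 / 5))
    (hFCP : FrustratedCorePricingG (3 / 20) (1 / 10) (6 / 5) 10 (1 / 100) 40 (3 / 5))
    (hCCP : CoherentCorePricingG (3 / 20) (1 / 10) (6 / 5) 10 (1 / 100) 40 (1 / 10) 40 (3 / 5))
    (hB : CoreBallRegularPricingW W (1 / 20) (3 / 5) 10 fun _ _ => True)
    (hLab : CleanLabellingW W (3 / 5) 10 (1 / 3) 3)
    (hSB : ShellBudgetW W (3 / 5) 100000)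
    (hS : SeamTransferBoundC (3 / 5) (1 / 3) 3 (1 / 100) (3 / 100) (1 / 2) ϱ (2 / 5) 3 (1 / 3000000))
    (hN : SeamReductionW (3 / 5) (1 / 3) 3 (1 / 100) (3 / 100) (1 / 2) ϱ (2 / 5) 3 (1 / 3000000) W (1 / 20) 10 100000)
    (hP : ChartedChargePricingG (3 / 20) (1 / 10) (3 / 5)) : ChargedEnergyGap :=
  chargedEnergyGap_of_budgetLedger W hF hIP hFCP hCCP hB hLab hSB (farLabelledFloorCoredBudgetW_of_seam hS hN) hP

/-- ★★ **THE MAX-COVER TEN-LEAF RECORD CONE** at `ϱ = 160` (record-designate R1): `ChargeRecount · IP_G · FCP_G · CCP_G · REG-BALL_M ·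
LABEL_M · SHELL-BUDGET_M(10⁵) · SEAM-TRANSFER(1/(3·10⁶), 2/5, 3) · SEAM-REDUCTION_M · P_G ⟹ ChargedEnergyGap`. -/
theorem chargedEnergyGap_of_maxCoverSeamLedger_record (hF : ChargeRecount)
    (hIP : ImprovablePricingG (3 / 20) (1 / 10) (6 / 5) 10 (1 / 100) (3 / 5))
    (hFCP : FrustratedCorePricingG (3 / 20) (1 / 10) (6 / 5) 10 (1 / 100) 40 (3 / 5))
    (hCCP : CoherentCorePricingG (3 / 20) (1 / 10) (6 / 5) 10 (1 / 100) 40 (1 / 10) 40 (3 / 5))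
    (hB : CoreBallRegularPricingW (maxCoverWeights (3 / 20) (1 / 10) (6 / 5) 10 (1 / 100) 40 (1 / 10) 40 160) (1 / 20) (3 / 5) 10
      fun _ _ => True)
    (hLab : CleanLabellingW (maxCoverWeights (3 / 20) (1 / 10) (6 / 5) 10 (1 / 100) 40 (1 / 10) 40 160) (3 / 5) 10 (1 / 3) 3)
    (hSB : ShellBudgetW (maxCoverWeights (3 / 20) (1 / 10) (6 / 5) 10 (1 / 100) 40 (1 / 10) 40 160) (3 / 5) 100000)
    (hS : SeamTransferBoundC (3 / 5) (1 / 3) 3 (1 / 100) (3 / 100) (1 / 2) 160 (2 / 5) 3 (1 / 3000000))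
    (hN : SeamReductionW (3 / 5) (1 / 3) 3 (1 / 100) (3 / 100) (1 / 2) 160 (2 / 5) 3 (1 / 3000000)
      (maxCoverWeights (3 / 20) (1 / 10) (6 / 5) 10 (1 / 100) 40 (1 / 10) 40 160) (1 / 20) 10 100000)
    (hP : ChartedChargePricingG (3 / 20) (1 / 10) (3 / 5)) : ChargedEnergyGap :=
  chargedEnergyGap_of_maxCoverBudgetLedger_record hF hIP hFCP hCCP hB hLab hSB (farLabelledFloorCoredBudgetW_of_seam hS hN) hP

/-- The P-B record cone is RECOVERED from the P-C pieces (consistency of the two generations: (Hˢ) ⟹ (H♯) at `2/5 ≤ 3/5` and (N♯) given). -/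
theorem chargedEnergyGap_of_seam_via_volterra {ϱ : ℝ} (W : CoreWeights (3 / 20) (1 / 10) (6 / 5) 10 (1 / 100) 40 (1 / 10) 40 ϱ)
    (hF : ChargeRecount)
    (hIP : ImprovablePricingG (3 / 20) (1 / 10) (6 / 5) 10 (1 / 100) (3 / 5))
    (hFCP : FrustratedCorePricingG (3 / 20) (1 / 10) (6 / 5) 10 (1 / 100) 40 (3 / 5))
    (hCCP : CoherentCorePricingG (3 / 20) (1 / 10) (6 / 5) 10 (1 / 100) 40 (1 / 10) 40 (3 / 5))
    (hB : CoreBallRegularPricingW W (1 / 20) (3 / 5) 10 fun _ _ => True)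
    (hLab : CleanLabellingW W (3 / 5) 10 (1 / 3) 3)
    (hSB : ShellBudgetW W (3 / 5) 100000)
    (hS : SeamTransferBoundC (3 / 5) (1 / 3) 3 (1 / 100) (3 / 100) (1 / 2) ϱ (2 / 5) 3 (1 / 3000000))
    (hN : VolterraReductionW (3 / 5) (1 / 3) 3 (1 / 100) (3 / 100) (1 / 2) ϱ 3 (1 / 3000000) W (1 / 20) 10 100000)
    (hP : ChartedChargePricingG (3 / 20) (1 / 10) (3 / 5)) : ChargedEnergyGap :=
  chargedEnergyGap_of_volterraLedger W hF hIP hFCP hCCP hB hLab hSB (volterraTransferBoundC_of_seam record_floor_le_sep hS) hN hP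

end Record

end Summit.AtomisticToContinuum.Crystallization.Theorems.ChargedEnergyGapChartDial

end

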